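import Literature.Computability.Complexity.TableauCSPEval
import Literature.Computability.Complexity.CodeFPListKit
import Literature.Computability.Complexity.CodeFPLists
import Literature.Computability.Complexity.CodeFPBudgets
import Literature.Computability.Complexity.CodeFPStrings
import HarnessLib

/-!
# Evaluating the arithmetized tableau in polynomial time (`CodeFP` programmes for `TableauCSPEval`)

Literature / complexity toolkit, machine-layer brick of the probabilistically checkable proofs for
exponential-time computations (Babai–Fortnow–Lund 1991, §4; Babai–Fortnow–Levin–Szegedy 1991, §5:
"the verifier evaluates the arithmetized clauses itself, in time polynomial in the length of the
variables"). `TableauCSPEval.lean` defined the residue-level evaluation of the constraint families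
of the arithmetized Cook–Levin tableau `TableauCSP.tableauCSP M L P T x` — read addresses `addrN`,
guards and clause values, the seeded sum `psiN = ∑ᵢ seedⁱ · valueᵢ`, the descriptor list `descs` —
and proved it computes the field quantities of `AlgebraicPCP` (`cast_psiN`, `readAddr_eq_addrN`).
This file proves that these maps are POLYNOMIAL TIME in the typed algebra `CodeFP` (`CodeFP.lean`
ff., `CodeFPModArith.lean` for residue arithmetic with the modulus carried as data):

* `foldlPair` — a left fold whose accumulator is a PAIR OF RESIDUES below a bound read off the
  context is polynomial time (the one custom accumulator bound of this file; everything else is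
  `map` + the running sums/products of `CodeFPModArith`);
* the digit polynomials: `eqCNC`, `ltDNC`, `eqVNC`, `succDNC`; `eqltC` (the pair
  `(EQCN, LTCN)` by a right-to-left fold along the digits paired with the successive quotients of
  the constant, `foldl_eqltStep`), `eqvSuccC` (the pair `(EQVN, SUCCN)`, `foldl_evsStep`);
* the tableau: `tDC`, `t'DC`, `cDC` (slices), `LTCNC`/`SUCCNC` at the parameter record, the guards
  `stepGNC`, `cellGNC`, `tailGNC`, `intGNC`, `guardNC`, the clause value `clauseNC`, `famValNC`,
  and **`psiNC`** — `(π, seed, z, reads, descriptors) ↦ psiN (max q 1) …` for the parameter record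
  `π = (q, 1ʰ, 1^{kt}, 1^{kJ}, n, 1ᴾ, T)` (`Prm`, code `prmE`); the modulus actually used is
  `max q 1` (`p1`), which is `q` at every prime and keeps every residue below the modulus on junk
  inputs too;
* the addresses **`addrNC`** (and `addrsNC`, all reads of all descriptors) and the descriptor
  list **`descsC`** — `((n, 1ᴾ, T), x) ↦ descs M n P T x` (the `M`-dependent blocks are constants).

Everything is proved; no machine, transducer or growth estimate is written beyond the typed
combinators; no named fact.

## References

* L. Babai, L. Fortnow, L. Levin, M. Szegedy, *Checking computations in polylogarithmic time*,
  STOC 1991, §5 [BFLS1991].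
* L. Babai, L. Fortnow, C. Lund, *Non-deterministic exponential time has two-prover interactive
  protocols*, Comput. Complexity 1 (1991), §4 [BabaiFortnowLund1991].
* S. Arora, B. Barak, *Computational Complexity: A Modern Approach*, CUP 2009, §1.3 (polynomial
  time is closed under composition and polynomially bounded loops), §8.6, §11.5.2 [AroraBarakCC2009].
-/

noncomputable section

open Finset Polynomial

namespace Literature.Computability.Complexity

namespace TabEval

open ModArith CodeFP Turing Tableau TableauCSP

/-! ### The working modulus -/

/-- The working modulus `max q 1` (equal to `q` at every prime; never `0`). [folklore] -/
def p1 (q : ℕ) : ℕ := max q 1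

/-- `1 ≤ p1 q`. [folklore] -/
theorem one_le_p1 (q : ℕ) : 1 ≤ p1 q := le_max_right _ _

/-- `p1 q = q` for `q ≥ 1`. [folklore] -/
theorem p1_eq {q : ℕ} (hq : 1 ≤ q) : p1 q = q := max_eq_left hq

/-- `p1 p = p` at a prime. [folklore] -/
theorem p1_prime {p : ℕ} [hp : Fact p.Prime] : p1 p = p := p1_eq hp.out.one_lt.le

/-- A reduced residue is below the working modulus. [folklore] -/
theorem mod_lt_p1 (q x : ℕ) : x % p1 q < p1 q := Nat.mod_lt _ (one_le_p1 q)

/-- The code of the working modulus is at most one bit longer. [folklore] -/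
theorem length_natE_p1 (q : ℕ) : (natE (p1 q)).length ≤ (natE q).length + 1 := by
  unfold p1
  rcases Nat.lt_or_ge q 1 with h | h
  · have : q = 0 := by omega
    subst this
    decide
  · rw [max_eq_left h]; omega

/-- `p1` is polynomial time. [folklore] -/
theorem p1C : CodeFP natE natE p1 := natMax.comp ((CodeFP.id natE).pair (CodeFP.const natE 1))

/-! ### Residues stay below the working modulus -/

section Bounds

variable (q h : ℕ) (hq : 1 ≤ q)
include hq

/-- `mulM q a b < q`. [folklore] -/
theorem mulM_lt (a b : ℕ) : mulM q a b < q := Nat.mod_lt _ hq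

/-- `addM q a b < q`. [folklore] -/
theorem addM_lt (a b : ℕ) : addM q a b < q := Nat.mod_lt _ hq

/-- `1 % q < q`. [folklore] -/
theorem one_mod_lt : 1 % q < q := Nat.mod_lt _ hq

/-- `EQCN < q`. [folklore] -/
theorem EQCN_lt (c : ℕ) (us : List ℕ) : EQCN q h c us < q := by
  cases us with
  | nil => unfold EQCN; split_ifs; exacts [one_mod_lt q hq, hq]
  | cons u us => exact mulM_lt q hq _ _

/-- `LTCN < q`. [folklore] -/
theorem LTCN_lt (c : ℕ) (us : List ℕ) : LTCN q h c us < q := by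
  cases us with
  | nil => unfold LTCN; split_ifs; exacts [one_mod_lt q hq, hq]
  | cons u us => exact addM_lt q hq _ _

/-- `EQVN < q`. [folklore] -/
theorem EQVN_lt (l : List (ℕ × ℕ)) : EQVN q h l < q := by
  cases l with
  | nil => exact one_mod_lt q hq
  | cons uv l => exact mulM_lt q hq _ _

/-- `SUCCN < q`. [folklore] -/
theorem SUCCN_lt (l : List (ℕ × ℕ)) : SUCCN q h l < q := by
  cases l with
  | nil => exact hq
  | cons uv l => exact addM_lt q hq _ _

end Bounds

/-! ### Folds with a pair of residues as accumulator -/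

section PairFold

variable {α σ : Type} {eα : α → List Bool} {eσ : σ → List Bool}

/-- **A left fold whose accumulator is a pair of numbers below a bound read off the context** is
polynomial time: the accumulator code is no longer than `3 (|context| + 1) + 2`.
[cite: AroraBarakCC2009, §1.3 (polynomially bounded loops)] -/
theorem foldlPair {step : σ → α → ℕ × ℕ → ℕ × ℕ} {init : σ → ℕ × ℕ} (B : σ → ℕ)
    (hstep : CodeFP (pairE eσ (pairE eα (pairE natE natE))) (pairE natE natE) (fun t => step t.1 t.2.1 t.2.2))
    (hinit : CodeFP eσ (pairE natE natE) init)
    (hB : ∀ s, (natE (B s)).length ≤ (eσ s).length + 1)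
    (hsB : ∀ s a st, (step s a st).1 < B s ∧ (step s a st).2 < B s)
    (hiB : ∀ s, (init s).1 < B s ∧ (init s).2 < B s) :
    CodeFP (pairE eσ (rawE eα)) (pairE natE natE) (fun t => t.2.foldl (fun b a => step t.1 a b) (init t.1)) := by
  refine CodeFP.foldl hstep hinit (3 * X + 6) fun s l₁ l₂ => ?_
  have hv : (l₁.foldl (fun b a => step s a b) (init s)).1 < B s ∧ (l₁.foldl (fun b a => step s a b) (init s)).2 < B s := by
    induction l₁ using List.reverseRecOn with
    | nil => exact hiB s
    | append_singleton l a _ => rw [List.foldl_append, List.foldl_cons, List.foldl_nil]; exact hsB s a _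
  have h1 := (length_natE_mono hv.1.le).trans (hB s)
  have h2 := (length_natE_mono hv.2.le).trans (hB s)
  set v := l₁.foldl (fun b a => step s a b) (init s)
  have e1 : (pairE natE natE v).length = 2 * (natE v.1).length + 2 + (natE v.2).length := by
    rw [pairE_apply, length_boolPair]
  have e2 : (pairE eσ (rawE eα) (s, l₁ ++ l₂)).length = 2 * (eσ s).length + 2 + (rawE eα (l₁ ++ l₂)).length := by
    rw [pairE_apply, length_boolPair]
  rw [e1, e2]
  simp only [eval_add, eval_mul, eval_X, eval_ofNat]
  omega

end PairFold

/-! ### One digit -/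

/-- The context `(q, 1ʰ)` of the digit arithmetic. [folklore] -/
abbrev qhE : ℕ × ℕ → List Bool := pairE natE unE

/-- `((q, 1ʰ), (e, a)) ↦ eqCN q h e a`. [cite: BFLS1991, §4] -/
theorem eqCNC : CodeFP (pairE qhE (pairE natE natE)) natE (fun t => eqCN t.1.1 t.1.2 t.2.1 t.2.2) := by
  have hlt : CodeFP (pairE qhE (pairE natE natE)) bitE (fun t => decide (t.2.1 < t.1.2)) :=
    natLt.comp ((CodeFP.snd _ _).fst'.pair (natOfUn.comp (CodeFP.fst _ _).snd'))
  refine (CodeFP.ite hlt lagrMod (CodeFP.const _ 0)).congr fun t => ?_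
  unfold eqCN
  by_cases h : t.2.1 < t.1.2 <;> simp [h]

/-- `((q, 1ʰ), (c, a)) ↦ ltDN q h c a`. [folklore] -/
theorem ltDNC : CodeFP (pairE qhE (pairE natE natE)) natE (fun t => ltDN t.1.1 t.1.2 t.2.1 t.2.2) := by
  -- the list of `e < min c h`
  have hL : CodeFP (pairE qhE (pairE natE natE)) (rawE natE) (fun t => List.range (min t.2.1 t.1.2)) :=
    urange.comp (unOfNatMin.comp ((CodeFP.fst _ _).snd'.pair (CodeFP.snd _ _).fst'))
  -- item `e ↦ eqCN q h e a`
  have hI : CodeFP (pairE (pairE qhE (pairE natE natE)) natE) natE (fun t => eqCN t.1.1.1 t.1.1.2 t.2 t.1.2.2) :=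
    eqCNC.comp ((CodeFP.fst _ _).fst'.pair ((CodeFP.snd _ _).pair (CodeFP.fst _ _).snd'.snd'))
  exact (modSum (CodeFP.fst _ _).fst' ((CodeFP.map hI).comp ((CodeFP.id _).pair hL))).congr fun t => rfl

/-- `((q, 1ʰ), (a, b)) ↦ eqVN q h a b`. [cite: BFLS1991, §4] -/
theorem eqVNC : CodeFP (pairE qhE (pairE natE natE)) natE (fun t => eqVN t.1.1 t.1.2 t.2.1 t.2.2) := by
  have hL : CodeFP (pairE qhE (pairE natE natE)) (rawE natE) (fun t => List.range t.1.2) := urange.comp (CodeFP.fst _ _).snd'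
  have hC : CodeFP (pairE (pairE qhE (pairE natE natE)) natE) qhE (fun t => t.1.1) := (CodeFP.fst _ _).fst'
  have hA : CodeFP (pairE (pairE qhE (pairE natE natE)) natE) natE (fun t => eqCN t.1.1.1 t.1.1.2 t.2 t.1.2.1) :=
    eqCNC.comp (hC.pair ((CodeFP.snd _ _).pair (CodeFP.fst _ _).snd'.fst'))
  have hB : CodeFP (pairE (pairE qhE (pairE natE natE)) natE) natE (fun t => eqCN t.1.1.1 t.1.1.2 t.2 t.1.2.2) :=
    eqCNC.comp (hC.pair ((CodeFP.snd _ _).pair (CodeFP.fst _ _).snd'.snd'))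
  exact (modSum (CodeFP.fst _ _).fst' ((CodeFP.map (modMul hC.fst' hA hB)).comp ((CodeFP.id _).pair hL))).congr fun t => rfl

/-- `((q, 1ʰ), (a, b)) ↦ succDN q h a b`. [folklore] -/
theorem succDNC : CodeFP (pairE qhE (pairE natE natE)) natE (fun t => succDN t.1.1 t.1.2 t.2.1 t.2.2) := by
  have hL : CodeFP (pairE qhE (pairE natE natE)) (rawE natE) (fun t => List.range (t.1.2 - 1)) := by
    have h1 : CodeFP (pairE qhE (pairE natE natE)) unE (fun t => min (t.1.2 - 1) t.1.2) :=
      unOfNatMin.comp ((CodeFP.fst _ _).snd'.pair (natSub.comp ((natOfUn.comp (CodeFP.fst _ _).snd').pair (CodeFP.const _ 1))))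
    exact (urange.comp h1).congr fun t => by simp
  have hC : CodeFP (pairE (pairE qhE (pairE natE natE)) natE) qhE (fun t => t.1.1) := (CodeFP.fst _ _).fst'
  have hA : CodeFP (pairE (pairE qhE (pairE natE natE)) natE) natE (fun t => eqCN t.1.1.1 t.1.1.2 t.2 t.1.2.1) :=
    eqCNC.comp (hC.pair ((CodeFP.snd _ _).pair (CodeFP.fst _ _).snd'.fst'))
  have hB : CodeFP (pairE (pairE qhE (pairE natE natE)) natE) natE (fun t => eqCN t.1.1.1 t.1.1.2 (t.2 + 1) t.1.2.2) :=
    eqCNC.comp (hC.pair ((natAdd.comp ((CodeFP.snd _ _).pair (CodeFP.const _ 1))).pair (CodeFP.fst _ _).snd'.snd'))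
  exact (modSum (CodeFP.fst _ _).fst' ((CodeFP.map (modMul hC.fst' hA hB)).comp ((CodeFP.id _).pair hL))).congr fun t => rfl

/-! ### `EQCN` and `LTCN` by a right-to-left fold -/

/-- The successive quotients `c, c/h, c/h², …` (`k` of them). [folklore] -/
def divsL (h : ℕ) : ℕ → ℕ → List ℕ
  | _, 0 => []
  | c, k + 1 => c :: divsL h (c / h) k

/-- The successive quotients in closed form. [folklore] -/
theorem divsL_eq (h : ℕ) : ∀ (c k : ℕ), divsL h c k = (List.range k).map fun i => c / h ^ i
  | c, 0 => rfl
  | c, k + 1 => by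
    rw [divsL, List.range_succ_eq_map, List.map_cons, List.map_map, divsL_eq h (c / h) k]
    simp only [pow_zero, Nat.div_one, List.cons.injEq, true_and]
    refine List.map_congr_left fun i _ => ?_
    simp only [Function.comp_apply, pow_succ']
    rw [Nat.div_div_eq_div_mul]

/-- Length of the quotient list. [folklore] -/
theorem length_divsL (h c k : ℕ) : (divsL h c k).length = k := by rw [divsL_eq]; simp

/-- One step of the `(EQCN, LTCN)` fold: digit `u`, quotient `cq` (its residue `cq % h` is the
digit of the constant at this position). [folklore] -/
def eqltStep (q h : ℕ) (st : ℕ × ℕ) (uq : ℕ × ℕ) : ℕ × ℕ :=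
  (mulM q (eqCN q h (uq.2 % h) uq.1) st.1, addM q st.2 (mulM q st.1 (ltDN q h (uq.2 % h) uq.1)))

/-- The base of the `(EQCN, LTCN)` fold at the top quotient `cK = c / h^k`. [folklore] -/
def eqltBase (q cK : ℕ) : ℕ × ℕ := (if cK = 0 then 1 % q else 0, if 0 < cK then 1 % q else 0)

/-- **The fold computes `(EQCN, LTCN)`**: folding `eqltStep` from the most significant digit down,
over the digits zipped with the successive quotients, from the base at `c / h^{|us|}`. [folklore] -/
theorem foldl_eqltStep (q h : ℕ) : ∀ (us : List ℕ) (c : ℕ),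
    ((us.zip (divsL h c us.length)).reverse).foldl (eqltStep q h) (eqltBase q (c / h ^ us.length)) =
      (EQCN q h c us, LTCN q h c us)
  | [], c => by simp [eqltBase, EQCN, LTCN]
  | u :: us, c => by
    rw [List.length_cons, divsL, List.zip_cons_cons, List.reverse_cons, List.foldl_append, List.foldl_cons, List.foldl_nil,
      show c / h ^ (us.length + 1) = c / h / h ^ us.length by rw [pow_succ', ← Nat.div_div_eq_div_mul],
      foldl_eqltStep q h us (c / h)]
    rfl

/-- The context `((q, 1ʰ), extra)` with the modulus replaced by the working modulus. [folklore] -/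
theorem qhP1 {β : Type} (eβ : β → List Bool) : CodeFP (pairE qhE eβ) qhE (fun t => (p1 t.1.1, t.1.2)) :=
  (p1C.comp (CodeFP.fst _ _).fst').pair (CodeFP.fst _ _).snd'

/-- `((q, 1ʰ), (c, us)) ↦ (EQCN (max q 1) h c us, LTCN (max q 1) h c us)`. [cite: BFLS1991, §4] -/
theorem eqltC : CodeFP (pairE qhE (pairE natE (rawE natE))) (pairE natE natE)
    (fun t => (EQCN (p1 t.1.1) t.1.2 t.2.1 t.2.2, LTCN (p1 t.1.1) t.1.2 t.2.1 t.2.2)) := by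
  have hlen : CodeFP (pairE qhE (pairE natE (rawE natE))) unE (fun t => t.2.2.length) := (ulength natE).comp (CodeFP.snd _ _).snd'
  have hcK : CodeFP (pairE qhE (pairE natE (rawE natE))) natE (fun t => t.2.1 / t.1.2 ^ t.2.2.length) :=
    natDiv.comp ((CodeFP.snd _ _).fst'.pair (natPow.comp ((natOfUn.comp (CodeFP.fst _ _).snd').pair hlen)))
  -- the quotient list `[c / h^i | i < |us|]` (exponent `i` made unary against the budget `|us|`)
  have hdivs : CodeFP (pairE qhE (pairE natE (rawE natE))) (rawE natE) (fun t => divsL t.1.2 t.2.1 t.2.2.length) := by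
    have hI : CodeFP (pairE (pairE qhE (pairE natE (rawE natE))) natE) natE
        (fun t => t.1.2.1 / t.1.1.2 ^ min t.2 t.1.2.2.length) :=
      natDiv.comp ((CodeFP.fst _ _).snd'.fst'.pair (natPow.comp ((natOfUn.comp (CodeFP.fst _ _).fst'.snd').pair
        (unOfNatMin.comp (((ulength natE).comp (CodeFP.fst _ _).snd'.snd').pair (CodeFP.snd _ _))))))
    refine ((CodeFP.map hI).comp ((CodeFP.id _).pair (urange.comp hlen))).congr fun t => ?_
    dsimp only [Function.comp_apply, id_eq]
    rw [divsL_eq]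
    refine List.map_congr_left fun i hi => ?_
    rw [min_eq_left (List.mem_range.1 hi).le]
  have hlist : CodeFP (pairE qhE (pairE natE (rawE natE))) (rawE (pairE natE natE))
      (fun t => (t.2.2.zip (divsL t.1.2 t.2.1 t.2.2.length)).reverse) :=
    (rawReverse _).comp ((rawZip natE natE).comp ((CodeFP.snd _ _).snd'.pair hdivs))
  -- the fold, with the working modulus inside the step and the base
  have hstep : CodeFP (pairE (pairE qhE natE) (pairE (pairE natE natE) (pairE natE natE))) (pairE natE natE)
      (fun t => eqltStep (p1 t.1.1.1) t.1.1.2 t.2.2 t.2.1) := by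
    have hC : CodeFP (pairE (pairE qhE natE) (pairE (pairE natE natE) (pairE natE natE))) qhE (fun t => (p1 t.1.1.1, t.1.1.2)) :=
      (qhP1 natE).comp (CodeFP.fst _ _)
    have hu : CodeFP (pairE (pairE qhE natE) (pairE (pairE natE natE) (pairE natE natE))) natE (fun t => t.2.1.1) := (CodeFP.snd _ _).fst'.fst'
    have he : CodeFP (pairE (pairE qhE natE) (pairE (pairE natE natE) (pairE natE natE))) natE (fun t => t.2.1.2 % t.1.1.2) :=
      natMod.comp ((CodeFP.snd _ _).fst'.snd'.pair (natOfUn.comp (CodeFP.fst _ _).fst'.snd'))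
    have hE : CodeFP (pairE (pairE qhE natE) (pairE (pairE natE natE) (pairE natE natE))) natE (fun t => t.2.2.1) := (CodeFP.snd _ _).snd'.fst'
    have hLv : CodeFP (pairE (pairE qhE natE) (pairE (pairE natE natE) (pairE natE natE))) natE (fun t => t.2.2.2) := (CodeFP.snd _ _).snd'.snd'
    have h1 : CodeFP (pairE (pairE qhE natE) (pairE (pairE natE natE) (pairE natE natE))) natE
        (fun t => eqCN (p1 t.1.1.1) t.1.1.2 (t.2.1.2 % t.1.1.2) t.2.1.1) := eqCNC.comp (hC.pair (he.pair hu))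
    have h2 : CodeFP (pairE (pairE qhE natE) (pairE (pairE natE natE) (pairE natE natE))) natE
        (fun t => ltDN (p1 t.1.1.1) t.1.1.2 (t.2.1.2 % t.1.1.2) t.2.1.1) := ltDNC.comp (hC.pair (he.pair hu))
    exact ((modMul hC.fst' h1 hE).pair (modAdd hC.fst' hLv (modMul hC.fst' hE h2))).congr fun t => rfl
  have hinit : CodeFP (pairE qhE natE) (pairE natE natE) (fun s => eqltBase (p1 s.1.1) s.2) := by
    have hz : CodeFP (pairE qhE natE) bitE (fun s => decide (s.2 = 0)) := natEq.comp ((CodeFP.snd _ _).pair (CodeFP.const _ 0))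
    have hpos : CodeFP (pairE qhE natE) bitE (fun s => decide (0 < s.2)) := natLt.comp ((CodeFP.const _ 0).pair (CodeFP.snd _ _))
    have hone : CodeFP (pairE qhE natE) natE (fun s => 1 % p1 s.1.1) := modOf (p1C.comp (CodeFP.fst _ _).fst') (CodeFP.const _ 1)
    refine ((CodeFP.ite hz hone (CodeFP.const _ 0)).pair (CodeFP.ite hpos hone (CodeFP.const _ 0))).congr fun s => ?_
    unfold eqltBase
    by_cases h0 : s.2 = 0
    · simp [h0]
    · simp [h0, Nat.pos_of_ne_zero h0]
  have hfold := foldlPair (σ := (ℕ × ℕ) × ℕ) (eσ := pairE qhE natE) (α := ℕ × ℕ) (eα := pairE natE natE)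
    (step := fun s uq st => eqltStep (p1 s.1.1) s.1.2 st uq) (init := fun s => eqltBase (p1 s.1.1) s.2) (fun s => p1 s.1.1)
    hstep hinit (fun s => by
      show (natE (p1 s.1.1)).length ≤ (boolPair (boolPair (natE s.1.1) (unE s.1.2)) (natE s.2)).length + 1
      rw [length_boolPair, length_boolPair]
      have := length_natE_p1 s.1.1
      omega)
    (fun s a st => ⟨mulM_lt _ (one_le_p1 _) _ _, addM_lt _ (one_le_p1 _) _ _⟩)
    (fun s => by
      unfold eqltBase
      constructor <;> split_ifs <;> first | exact one_mod_lt _ (one_le_p1 _) | exact one_le_p1 _)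
  refine (hfold.comp (((CodeFP.fst _ _).pair hcK).pair hlist)).congr fun t => ?_
  exact foldl_eqltStep (p1 t.1.1) t.1.2 t.2.2 t.2.1

/-! ### `EQVN` and `SUCCN` by a right-to-left fold -/

/-- One step of the `(EQVN, SUCCN)` fold on the digit pair `(u, v)`. [folklore] -/
def evsStep (q h : ℕ) (st : ℕ × ℕ) (uv : ℕ × ℕ) : ℕ × ℕ :=
  (mulM q (eqVN q h uv.1 uv.2) st.1,
    addM q (mulM q (succDN q h uv.1 uv.2) st.1) (mulM q (mulM q (eqCN q h (h - 1) uv.1) (eqCN q h 0 uv.2)) st.2))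

/-- **The fold computes `(EQVN, SUCCN)`**, from the most significant digit pair down. [folklore] -/
theorem foldl_evsStep (q h : ℕ) : ∀ l : List (ℕ × ℕ),
    (l.reverse).foldl (evsStep q h) (1 % q, 0) = (EQVN q h l, SUCCN q h l)
  | [] => by simp [EQVN, SUCCN]
  | uv :: l => by
    rw [List.reverse_cons, List.foldl_append, List.foldl_cons, List.foldl_nil, foldl_evsStep q h l]
    rfl

/-- `((q, 1ʰ), l) ↦ (EQVN (max q 1) h l, SUCCN (max q 1) h l)`. [cite: BabaiFortnowLund1991, §4] -/
theorem eqvSuccC : CodeFP (pairE qhE (rawE (pairE natE natE))) (pairE natE natE)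
    (fun t => (EQVN (p1 t.1.1) t.1.2 t.2, SUCCN (p1 t.1.1) t.1.2 t.2)) := by
  have hstep : CodeFP (pairE qhE (pairE (pairE natE natE) (pairE natE natE))) (pairE natE natE)
      (fun t => evsStep (p1 t.1.1) t.1.2 t.2.2 t.2.1) := by
    have hC : CodeFP (pairE qhE (pairE (pairE natE natE) (pairE natE natE))) qhE (fun t => (p1 t.1.1, t.1.2)) := qhP1 _
    have hu : CodeFP (pairE qhE (pairE (pairE natE natE) (pairE natE natE))) natE (fun t => t.2.1.1) := (CodeFP.snd _ _).fst'.fst'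
    have hv : CodeFP (pairE qhE (pairE (pairE natE natE) (pairE natE natE))) natE (fun t => t.2.1.2) := (CodeFP.snd _ _).fst'.snd'
    have hV : CodeFP (pairE qhE (pairE (pairE natE natE) (pairE natE natE))) natE (fun t => t.2.2.1) := (CodeFP.snd _ _).snd'.fst'
    have hS : CodeFP (pairE qhE (pairE (pairE natE natE) (pairE natE natE))) natE (fun t => t.2.2.2) := (CodeFP.snd _ _).snd'.snd'
    have h1 : CodeFP (pairE qhE (pairE (pairE natE natE) (pairE natE natE))) natE (fun t => eqVN (p1 t.1.1) t.1.2 t.2.1.1 t.2.1.2) :=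
      eqVNC.comp (hC.pair (hu.pair hv))
    have h2 : CodeFP (pairE qhE (pairE (pairE natE natE) (pairE natE natE))) natE (fun t => succDN (p1 t.1.1) t.1.2 t.2.1.1 t.2.1.2) :=
      succDNC.comp (hC.pair (hu.pair hv))
    have h3 : CodeFP (pairE qhE (pairE (pairE natE natE) (pairE natE natE))) natE (fun t => eqCN (p1 t.1.1) t.1.2 (t.1.2 - 1) t.2.1.1) :=
      eqCNC.comp (hC.pair ((natSub.comp ((natOfUn.comp (CodeFP.fst _ _).snd').pair (CodeFP.const _ 1))).pair hu))
    have h4 : CodeFP (pairE qhE (pairE (pairE natE natE) (pairE natE natE))) natE (fun t => eqCN (p1 t.1.1) t.1.2 0 t.2.1.2) :=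
      eqCNC.comp (hC.pair ((CodeFP.const _ 0).pair hv))
    exact ((modMul hC.fst' h1 hV).pair (modAdd hC.fst' (modMul hC.fst' h2 hV) (modMul hC.fst' (modMul hC.fst' h3 h4) hS))).congr
      fun t => rfl
  have hinit : CodeFP qhE (pairE natE natE) (fun s => (1 % p1 s.1, 0)) :=
    (modOf (p1C.comp (CodeFP.fst _ _)) (CodeFP.const _ 1)).pair (CodeFP.const _ 0)
  have hfold := foldlPair (σ := ℕ × ℕ) (eσ := qhE) (α := ℕ × ℕ) (eα := pairE natE natE)
    (step := fun s uv st => evsStep (p1 s.1) s.2 st uv) (init := fun s => (1 % p1 s.1, 0)) (fun s => p1 s.1)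
    hstep hinit (fun s => by
      show (natE (p1 s.1)).length ≤ (boolPair (natE s.1) (unE s.2)).length + 1
      rw [length_boolPair]
      have := length_natE_p1 s.1
      omega)
    (fun s a st => ⟨mulM_lt _ (one_le_p1 _) _ _, addM_lt _ (one_le_p1 _) _ _⟩)
    (fun s => ⟨one_mod_lt _ (one_le_p1 _), one_le_p1 _⟩)
  refine (hfold.comp ((CodeFP.fst _ _).pair ((rawReverse _).comp (CodeFP.snd _ _)))).congr fun t => ?_
  exact foldl_evsStep (p1 t.1.1) t.1.2 t.2

/-! ### The parameter record -/

/-- **The parameter record of the evaluation**: modulus `q` (binary), base `h`, digit counts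
`kt`, `kJ` (unary), input length `n` (binary), certificate bound `P` (unary), time bound `T`
(binary). [folklore] -/
structure Prm where
  /-- the claimed modulus -/
  q : ℕ
  /-- the base -/
  h : ℕ
  /-- row digits -/
  kt : ℕ
  /-- column digits -/
  kJ : ℕ
  /-- input length -/
  n : ℕ
  /-- certificate bound -/
  P : ℕ
  /-- time bound -/
  T : ℕ

/-- The record as a tuple. [folklore] -/
def Prm.tup (π : Prm) : ℕ × ℕ × ℕ × ℕ × ℕ × ℕ × ℕ := (π.q, π.h, π.kt, π.kJ, π.n, π.P, π.T)

/-- Code of the tuple. [folklore] -/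
abbrev tupE : ℕ × ℕ × ℕ × ℕ × ℕ × ℕ × ℕ → List Bool :=
  pairE natE (pairE unE (pairE unE (pairE unE (pairE natE (pairE unE natE)))))

/-- **Code of the parameter record** `(q, 1ʰ, 1^{kt}, 1^{kJ}, n, 1ᴾ, T)`. [folklore] -/
def prmE : Prm → List Bool := fun π => tupE π.tup

/-- The record as its tuple is free. [folklore] -/
theorem tupC : CodeFP prmE tupE Prm.tup := CodeFP.transparent fun _ => rfl

/-- `q`. [folklore] -/
theorem qC : CodeFP prmE natE Prm.q := (CodeFP.fst _ _).comp tupC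
/-- `h`. [folklore] -/
theorem hC : CodeFP prmE unE Prm.h := (CodeFP.snd _ _).fst'.comp tupC
/-- `kt`. [folklore] -/
theorem ktC : CodeFP prmE unE Prm.kt := (CodeFP.snd _ _).snd'.fst'.comp tupC
/-- `kJ`. [folklore] -/
theorem kJC : CodeFP prmE unE Prm.kJ := (CodeFP.snd _ _).snd'.snd'.fst'.comp tupC
/-- `n`. [folklore] -/
theorem nC : CodeFP prmE natE Prm.n := (CodeFP.snd _ _).snd'.snd'.snd'.fst'.comp tupC
/-- `P`. [folklore] -/
theorem PC : CodeFP prmE unE Prm.P := (CodeFP.snd _ _).snd'.snd'.snd'.snd'.fst'.comp tupC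
/-- `T`. [folklore] -/
theorem TC : CodeFP prmE natE Prm.T := (CodeFP.snd _ _).snd'.snd'.snd'.snd'.snd'.comp tupC
/-- `(max q 1, 1ʰ)`. [folklore] -/
theorem qhC : CodeFP prmE qhE (fun π => (p1 π.q, π.h)) := (p1C.comp qC).pair hC

/-- `NNn n P` off the record. [folklore] -/
theorem NNnC : CodeFP prmE natE (fun π => NNn π.n π.P) :=
  (natAdd.comp ((natAdd.comp ((natMul.comp ((CodeFP.const _ 2).pair nC)).pair (CodeFP.const _ 2))).pair (natOfUn.comp PC))).congr
    fun π => by simp [NNn]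

/-- `S1n d n P T` off the record (`d` a constant). [folklore] -/
theorem S1nC (dd : ℕ) : CodeFP prmE natE (fun π => S1n dd π.n π.P π.T) :=
  (natAdd.comp ((natAdd.comp (NNnC.pair (natMul.comp ((CodeFP.const _ dd).pair TC)))).pair (CodeFP.const _ (3 * dd)))).congr
    fun π => by simp [S1n]

/-! ### Slices of the index -/

section Slices

variable {β : Type} {eβ : β → List Bool}

/-- `drop` by a binary count (through the capped unary conversion). [folklore] -/
theorem rawDropNat {α : Type} (eα : α → List Bool) : CodeFP (pairE natE (rawE eα)) (rawE eα) (fun t => t.2.drop t.1) := by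
  have hu : CodeFP (pairE natE (rawE eα)) unE (fun t => min t.1 t.2.length) :=
    unOfNatMin.comp (((ulength eα).comp (CodeFP.snd _ _)).pair (CodeFP.fst _ _))
  refine (((rawDropUn eα).comp (hu.pair (CodeFP.snd _ _)))).congr fun t => ?_
  dsimp only
  rcases le_total t.1 t.2.length with h | h
  · rw [min_eq_left h]
  · rw [min_eq_right h, List.drop_eq_nil_of_le h, List.drop_eq_nil_of_le le_rfl]

/-- `tD` off `(π, zl)`. [folklore] -/
theorem tDC : CodeFP (pairE prmE (rawE natE)) (rawE natE) (fun t => tD t.1.kt t.2) :=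
  (rawTakeUn natE).comp ((ktC.comp (CodeFP.fst _ _)).pair (CodeFP.snd _ _))

/-- `t'D` off `(π, zl)`. [folklore] -/
theorem t'DC : CodeFP (pairE prmE (rawE natE)) (rawE natE) (fun t => t'D t.1.kt t.2) :=
  (rawTakeUn natE).comp ((ktC.comp (CodeFP.fst _ _)).pair ((rawDropUn natE).comp ((ktC.comp (CodeFP.fst _ _)).pair (CodeFP.snd _ _))))

/-- `cD c` off `((π, zl), c)`. [folklore] -/
theorem cDC : CodeFP (pairE (pairE prmE (rawE natE)) natE) (rawE natE) (fun t => cD t.1.1.kt t.1.1.kJ t.1.2 t.2) := by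
  have hπ : CodeFP (pairE (pairE prmE (rawE natE)) natE) prmE (fun t => t.1.1) := (CodeFP.fst _ _).fst'
  have hamt : CodeFP (pairE (pairE prmE (rawE natE)) natE) natE (fun t => t.1.1.kt + t.1.1.kt + t.1.1.kJ * t.2) :=
    natAdd.comp ((natAdd.comp ((natOfUn.comp (ktC.comp hπ)).pair (natOfUn.comp (ktC.comp hπ)))).pair
      (natMul.comp ((natOfUn.comp (kJC.comp hπ)).pair (CodeFP.snd _ _))))
  exact (rawTakeUn natE).comp ((kJC.comp hπ).pair ((rawDropNat natE).comp (hamt.pair (CodeFP.fst _ _).snd')))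

end Slices

/-! ### Guards -/

section Guards

variable (dd : ℕ)

/-- `LTCN (max q 1) h c us` off `(π, (c, us))`. [folklore] -/
theorem LTCNC : CodeFP (pairE prmE (pairE natE (rawE natE))) natE (fun t => LTCN (p1 t.1.q) t.1.h t.2.1 t.2.2) :=
  (eqltC.comp ((qhC.comp (CodeFP.fst _ _)).pair (CodeFP.snd _ _))).snd'.congr fun t => by simp [p1]

/-- `SUCCN (max q 1) h l` off `(π, l)`. [folklore] -/
theorem SUCCNC : CodeFP (pairE prmE (rawE (pairE natE natE))) natE (fun t => SUCCN (p1 t.1.q) t.1.h t.2) :=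
  (eqvSuccC.comp ((qhC.comp (CodeFP.fst _ _)).pair (CodeFP.snd _ _))).snd'.congr fun t => by simp [p1]

/-- The step guard off `(π, zl)`. [folklore] -/
theorem stepGNC : CodeFP (pairE prmE (rawE natE)) natE (fun t => stepGN (p1 t.1.q) t.1.h t.1.kt t.1.T t.2) := by
  have h1 : CodeFP (pairE prmE (rawE natE)) natE (fun t => LTCN (p1 t.1.q) t.1.h t.1.T (tD t.1.kt t.2)) :=
    LTCNC.comp ((CodeFP.fst _ _).pair ((TC.comp (CodeFP.fst _ _)).pair tDC))
  have h2 : CodeFP (pairE prmE (rawE natE)) natE (fun t => SUCCN (p1 t.1.q) t.1.h ((tD t.1.kt t.2).zip (t'D t.1.kt t.2))) :=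
    SUCCNC.comp ((CodeFP.fst _ _).pair ((rawZip natE natE).comp (tDC.pair t'DC)))
  exact (modMul (p1C.comp (qC.comp (CodeFP.fst _ _))) h1 h2).congr fun t => rfl

/-- The cell guard off `(π, zl)`. [folklore] -/
theorem cellGNC : CodeFP (pairE prmE (rawE natE)) natE (fun t => cellGN (p1 t.1.q) t.1.h t.1.kt t.1.kJ dd t.1.n t.1.P t.1.T t.2) := by
  have h1 : CodeFP (pairE prmE (rawE natE)) natE (fun t => LTCN (p1 t.1.q) t.1.h (t.1.T + 1) (tD t.1.kt t.2)) :=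
    LTCNC.comp ((CodeFP.fst _ _).pair ((natAdd.comp ((TC.comp (CodeFP.fst _ _)).pair (CodeFP.const _ 1))).pair tDC))
  have h2 : CodeFP (pairE prmE (rawE natE)) natE (fun t => LTCN (p1 t.1.q) t.1.h (S1n dd t.1.n t.1.P t.1.T + 1) (cD t.1.kt t.1.kJ t.2 0)) :=
    LTCNC.comp ((CodeFP.fst _ _).pair ((natAdd.comp (((S1nC dd).comp (CodeFP.fst _ _)).pair (CodeFP.const _ 1))).pair
      (cDC.comp ((CodeFP.id _).pair (CodeFP.const _ 0)))))
  exact (modMul (p1C.comp (qC.comp (CodeFP.fst _ _))) h1 h2).congr fun t => rfl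

/-- The tail guard off `(π, zl)`. [folklore] -/
theorem tailGNC : CodeFP (pairE prmE (rawE natE)) natE (fun t => tailGN (p1 t.1.q) t.1.h t.1.kt t.1.kJ dd t.1.n t.1.P t.1.T t.2) := by
  have hq : CodeFP (pairE prmE (rawE natE)) natE (fun t => p1 t.1.q) := p1C.comp (qC.comp (CodeFP.fst _ _))
  have hc0 : CodeFP (pairE prmE (rawE natE)) (rawE natE) (fun t => cD t.1.kt t.1.kJ t.2 0) := cDC.comp ((CodeFP.id _).pair (CodeFP.const _ 0))
  have h1 : CodeFP (pairE prmE (rawE natE)) natE (fun t => LTCN (p1 t.1.q) t.1.h (NNn t.1.n t.1.P + 1) (cD t.1.kt t.1.kJ t.2 0)) :=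
    LTCNC.comp ((CodeFP.fst _ _).pair ((natAdd.comp ((NNnC.comp (CodeFP.fst _ _)).pair (CodeFP.const _ 1))).pair hc0))
  have h2 : CodeFP (pairE prmE (rawE natE)) natE (fun t => LTCN (p1 t.1.q) t.1.h (S1n dd t.1.n t.1.P t.1.T + 1) (cD t.1.kt t.1.kJ t.2 0)) :=
    LTCNC.comp ((CodeFP.fst _ _).pair ((natAdd.comp (((S1nC dd).comp (CodeFP.fst _ _)).pair (CodeFP.const _ 1))).pair hc0))
  exact (modMul hq (modSub hq (CodeFP.const _ 1) h1) h2).congr fun t => rfl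

/-- The interior guard off `(π, zl)`. [folklore] -/
theorem intGNC : CodeFP (pairE prmE (rawE natE)) natE (fun t => intGN (p1 t.1.q) t.1.h t.1.kt t.1.kJ dd t.1.n t.1.P t.1.T t.2) := by
  have hq : CodeFP (pairE prmE (rawE natE)) natE (fun t => p1 t.1.q) := p1C.comp (qC.comp (CodeFP.fst _ _))
  have hc0 : CodeFP (pairE prmE (rawE natE)) (rawE natE) (fun t => cD t.1.kt t.1.kJ t.2 0) := cDC.comp ((CodeFP.id _).pair (CodeFP.const _ 0))
  -- the product of the column successor indicators, item `i ↦ SUCCN … ((cD i).zip (cD (i+1)))`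
  have hI : CodeFP (pairE (pairE prmE (rawE natE)) natE) natE
      (fun t => SUCCN (p1 t.1.1.q) t.1.1.h ((cD t.1.1.kt t.1.1.kJ t.1.2 t.2).zip (cD t.1.1.kt t.1.1.kJ t.1.2 (t.2 + 1)))) :=
    SUCCNC.comp ((CodeFP.fst _ _).fst'.pair ((rawZip natE natE).comp
      (cDC.pair (cDC.comp ((CodeFP.fst _ _).pair (natAdd.comp ((CodeFP.snd _ _).pair (CodeFP.const _ 1))))))))
  have hprod : CodeFP (pairE prmE (rawE natE)) natE (fun t => prodM (p1 t.1.q)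
      ((List.range (2 * dd)).map fun i => SUCCN (p1 t.1.q) t.1.h ((cD t.1.kt t.1.kJ t.2 i).zip (cD t.1.kt t.1.kJ t.2 (i + 1))))) :=
    modProd hq ((CodeFP.map hI).comp ((CodeFP.id _).pair (CodeFP.const _ (List.range (2 * dd)))))
  have h3 : CodeFP (pairE prmE (rawE natE)) natE (fun t => LTCN (p1 t.1.q) t.1.h (dd + 1) (cD t.1.kt t.1.kJ t.2 0)) :=
    LTCNC.comp ((CodeFP.fst _ _).pair ((CodeFP.const _ (dd + 1)).pair hc0))
  have h4 : CodeFP (pairE prmE (rawE natE)) natE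
      (fun t => LTCN (p1 t.1.q) t.1.h (dd + 1 + NNn t.1.n t.1.P + dd * t.1.T) (cD t.1.kt t.1.kJ t.2 0)) :=
    LTCNC.comp ((CodeFP.fst _ _).pair ((natAdd.comp ((natAdd.comp ((CodeFP.const _ (dd + 1)).pair (NNnC.comp (CodeFP.fst _ _)))).pair
      (natMul.comp ((CodeFP.const _ dd).pair (TC.comp (CodeFP.fst _ _)))))).pair hc0))
  exact (modMul hq (modMul hq (modMul hq stepGNC hprod) (modSub hq (CodeFP.const _ 1) h3)) h4).congr fun t => rfl

/-- **The guard of a tag** off `((π, zl), g)`. [folklore] -/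
theorem guardNC : CodeFP (pairE (pairE prmE (rawE natE)) natE) natE
    (fun t => guardN (p1 t.1.1.q) t.1.1.h t.1.1.kt t.1.1.kJ dd t.1.1.n t.1.1.P t.1.1.T t.1.2 t.2) := by
  have hg : ∀ c : ℕ, CodeFP (pairE (pairE prmE (rawE natE)) natE) bitE (fun t => decide (t.2 = c)) := fun c =>
    natEq.comp ((CodeFP.snd _ _).pair (CodeFP.const _ c))
  have hone : CodeFP (pairE (pairE prmE (rawE natE)) natE) natE (fun t => 1 % p1 t.1.1.q) :=
    modOf (p1C.comp (qC.comp (CodeFP.fst _ _).fst')) (CodeFP.const _ 1)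
  refine ((hg 0).ite hone ((hg 1).ite ((tailGNC dd).comp (CodeFP.fst _ _)) ((hg 2).ite (stepGNC.comp (CodeFP.fst _ _))
    ((hg 3).ite ((intGNC dd).comp (CodeFP.fst _ _)) ((cellGNC dd).comp (CodeFP.fst _ _)))))).congr fun t => ?_
  unfold guardN
  simp only [decide_eq_true_eq]

end Guards

/-! ### Clause values, family values, the seeded sum -/

section Values

variable (dd : ℕ)

/-- Code of a read descriptor. [folklore] -/
abbrev rdE : RdDesc → List Bool := pairE (pairE natE natE) (pairE (pairE natE natE) natE)

/-- Code of a family descriptor. [folklore] -/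
abbrev fdE : FamDesc → List Bool := pairE natE (pairE (rawE rdE) (pairE (rawE natE) (rawE natE)))

/-- **The clause value** off `(q, (prem, concl), ys)`. [cite: BabaiFortnowLund1991, §4] -/
theorem clauseNC : CodeFP (pairE natE (pairE (pairE (rawE natE) (rawE natE)) (rawE natE))) natE
    (fun t => clauseN t.1 t.2.1.1 t.2.1.2 t.2.2) := by
  have hget : CodeFP (pairE (pairE natE (pairE (pairE (rawE natE) (rawE natE)) (rawE natE))) natE) natE
      (fun t => t.1.2.2.getD t.2 0) := (rawGetD natE natE_zero).comp ((CodeFP.fst _ _).snd'.snd'.pair (CodeFP.snd _ _))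
  have hq : CodeFP (pairE (pairE natE (pairE (pairE (rawE natE) (rawE natE)) (rawE natE))) natE) natE (fun t => t.1.1) := (CodeFP.fst _ _).fst'
  have hprem : CodeFP (pairE natE (pairE (pairE (rawE natE) (rawE natE)) (rawE natE))) (rawE natE)
      (fun t => t.2.1.1.map fun j => t.2.2.getD j 0) := (CodeFP.map hget).comp ((CodeFP.id _).pair (CodeFP.snd _ _).fst'.fst')
  have hconcl : CodeFP (pairE natE (pairE (pairE (rawE natE) (rawE natE)) (rawE natE))) (rawE natE)
      (fun t => t.2.1.2.map fun j => subM t.1 1 (t.2.2.getD j 0)) :=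
    (CodeFP.map (modSub hq (CodeFP.const _ 1) hget)).comp ((CodeFP.id _).pair (CodeFP.snd _ _).fst'.snd')
  exact (modMul (CodeFP.fst _ _) (modProd (CodeFP.fst _ _) hprem) (modProd (CodeFP.fst _ _) hconcl)).congr fun t => rfl

/-- **The value of a described family** off `((π, zl), (ys, fd))`. [cite: BabaiFortnowLund1991, §4] -/
theorem famValNC : CodeFP (pairE (pairE prmE (rawE natE)) (pairE (rawE natE) fdE)) natE
    (fun t => famValN (p1 t.1.1.q) t.1.1.h t.1.1.kt t.1.1.kJ dd t.1.1.n t.1.1.P t.1.1.T t.1.2 t.2.1 t.2.2) := by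
  have hq : CodeFP (pairE (pairE prmE (rawE natE)) (pairE (rawE natE) fdE)) natE (fun t => p1 t.1.1.q) :=
    p1C.comp (qC.comp (CodeFP.fst _ _).fst')
  have hg : CodeFP (pairE (pairE prmE (rawE natE)) (pairE (rawE natE) fdE)) natE
      (fun t => guardN (p1 t.1.1.q) t.1.1.h t.1.1.kt t.1.1.kJ dd t.1.1.n t.1.1.P t.1.1.T t.1.2 t.2.2.1) :=
    (guardNC dd).comp ((CodeFP.fst _ _).pair (CodeFP.snd _ _).snd'.fst')
  have hc : CodeFP (pairE (pairE prmE (rawE natE)) (pairE (rawE natE) fdE)) natE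
      (fun t => clauseN (p1 t.1.1.q) t.2.2.2.2.1 t.2.2.2.2.2 t.2.1) :=
    clauseNC.comp (hq.pair ((CodeFP.snd _ _).snd'.snd'.snd'.pair (CodeFP.snd _ _).fst'))
  exact (modMul hq hg hc).congr fun t => rfl

/-- **The seeded sum of the family values** off `(π, seed, zl, yss, fds)` — the random combination
`Ψ_λ(z)` of the arithmetized tableau at the working modulus `max q 1`.
[cite: AroraBarakCC2009, §11.5.2] [cite: BFLS1991, §5] -/
theorem psiNC : CodeFP (pairE prmE (pairE natE (pairE (rawE natE) (pairE (rawE (rawE natE)) (rawE fdE))))) natE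
    (fun t => psiN (p1 t.1.q) t.1.h t.1.kt t.1.kJ dd t.1.n t.1.P t.1.T t.2.1 t.2.2.1 t.2.2.2.1 t.2.2.2.2) := by
  -- context `t`, item `(i, (fd, ys))`
  have hπ : CodeFP (pairE (pairE prmE (pairE natE (pairE (rawE natE) (pairE (rawE (rawE natE)) (rawE fdE))))) (pairE natE (pairE fdE (rawE natE))))
      prmE (fun t => t.1.1) := (CodeFP.fst _ _).fst'
  have hq : CodeFP (pairE (pairE prmE (pairE natE (pairE (rawE natE) (pairE (rawE (rawE natE)) (rawE fdE))))) (pairE natE (pairE fdE (rawE natE))))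
      natE (fun t => p1 t.1.1.q) := p1C.comp (qC.comp hπ)
  have hI : CodeFP (pairE (pairE prmE (pairE natE (pairE (rawE natE) (pairE (rawE (rawE natE)) (rawE fdE))))) (pairE natE (pairE fdE (rawE natE))))
      natE (fun t => mulM (p1 t.1.1.q) (powM (p1 t.1.1.q) t.1.2.1 t.2.1)
        (famValN (p1 t.1.1.q) t.1.1.h t.1.1.kt t.1.1.kJ dd t.1.1.n t.1.1.P t.1.1.T t.1.2.2.1 t.2.2.2 t.2.2.1)) :=
    modMul hq (modPow hq (CodeFP.fst _ _).snd'.fst' (CodeFP.snd _ _).fst')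
      ((famValNC dd).comp ((hπ.pair (CodeFP.fst _ _).snd'.snd'.fst').pair ((CodeFP.snd _ _).snd'.snd'.pair (CodeFP.snd _ _).snd'.fst')))
  have hL : CodeFP (pairE prmE (pairE natE (pairE (rawE natE) (pairE (rawE (rawE natE)) (rawE fdE))))) (rawE (pairE natE (pairE fdE (rawE natE))))
      (fun t => (List.range (t.2.2.2.2.zip t.2.2.2.1).length).zip (t.2.2.2.2.zip t.2.2.2.1)) :=
    (rawEnum _).comp ((rawZip _ _).comp ((CodeFP.snd _ _).snd'.snd'.snd'.pair (CodeFP.snd _ _).snd'.snd'.fst'))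
  exact (modSum (p1C.comp (qC.comp (CodeFP.fst _ _))) ((CodeFP.map hI).comp ((CodeFP.id _).pair hL))).congr fun t => rfl

end Values

/-! ### Addresses -/

section Addr

/-- The context `(1ʰ, 1^{kt}, 1^{kJ})` of the address arithmetic. [folklore] -/
abbrev hkE : ℕ × ℕ × ℕ → List Bool := pairE unE (pairE unE unE)

/-- `constDigits h k N` off `(1ʰ, 1ᵏ, N)`. [folklore] -/
theorem constDigitsC : CodeFP (pairE unE (pairE unE natE)) (rawE natE) (fun t => constDigits t.1 t.2.1 t.2.2) := by
  -- item `i ↦ N / h^(min i k) % h`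
  have hh : CodeFP (pairE (pairE unE (pairE unE natE)) natE) natE (fun t => t.1.1) := natOfUn.comp (CodeFP.fst _ _).fst'
  have hI : CodeFP (pairE (pairE unE (pairE unE natE)) natE) natE (fun t => t.1.2.2 / t.1.1 ^ min t.2 t.1.2.1 % t.1.1) :=
    natMod.comp ((natDiv.comp ((CodeFP.fst _ _).snd'.snd'.pair (natPow.comp (hh.pair (unOfNatMin.comp
      ((CodeFP.fst _ _).snd'.fst'.pair (CodeFP.snd _ _))))))).pair hh)
  refine ((CodeFP.map hI).comp ((CodeFP.id _).pair (urange.comp (CodeFP.snd _ _).fst'))).congr fun t => ?_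
  dsimp only [Function.comp_apply, id_eq]
  unfold constDigits
  refine List.map_congr_left fun i hi => ?_
  rw [min_eq_left (List.mem_range.1 hi).le]

/-- `rowDigs` off `((1ʰ, 1^{kt}, 1^{kJ}), zl, rs)`. [folklore] -/
theorem rowDigsC : CodeFP (pairE hkE (pairE (rawE natE) (pairE natE natE))) (rawE natE)
    (fun t => rowDigs t.1.1 t.1.2.1 t.2.1 t.2.2) := by
  have htag : ∀ c : ℕ, CodeFP (pairE hkE (pairE (rawE natE) (pairE natE natE))) bitE (fun t => decide (t.2.2.1 = c)) := fun c =>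
    natEq.comp ((CodeFP.snd _ _).snd'.fst'.pair (CodeFP.const _ c))
  have hconst : CodeFP (pairE hkE (pairE (rawE natE) (pairE natE natE))) (rawE natE) (fun t => constDigits t.1.1 t.1.2.1 t.2.2.2) :=
    constDigitsC.comp ((CodeFP.fst _ _).fst'.pair ((CodeFP.fst _ _).snd'.fst'.pair (CodeFP.snd _ _).snd'.snd'))
  have ht : CodeFP (pairE hkE (pairE (rawE natE) (pairE natE natE))) (rawE natE) (fun t => tD t.1.2.1 t.2.1) :=
    (rawTakeUn natE).comp ((CodeFP.fst _ _).snd'.fst'.pair (CodeFP.snd _ _).fst')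
  have ht' : CodeFP (pairE hkE (pairE (rawE natE) (pairE natE natE))) (rawE natE) (fun t => t'D t.1.2.1 t.2.1) :=
    (rawTakeUn natE).comp ((CodeFP.fst _ _).snd'.fst'.pair ((rawDropUn natE).comp ((CodeFP.fst _ _).snd'.fst'.pair (CodeFP.snd _ _).fst')))
  refine ((htag 0).ite hconst ((htag 1).ite ht ht')).congr fun t => ?_
  unfold rowDigs
  simp only [decide_eq_true_eq]

/-- `colDigs` off `((1ʰ, 1^{kt}, 1^{kJ}), zl, cs)`. [folklore] -/
theorem colDigsC : CodeFP (pairE hkE (pairE (rawE natE) (pairE natE natE))) (rawE natE)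
    (fun t => colDigs t.1.1 t.1.2.1 t.1.2.2 t.2.1 t.2.2) := by
  have htag : CodeFP (pairE hkE (pairE (rawE natE) (pairE natE natE))) bitE (fun t => decide (t.2.2.1 = 0)) :=
    natEq.comp ((CodeFP.snd _ _).snd'.fst'.pair (CodeFP.const _ 0))
  have hconst : CodeFP (pairE hkE (pairE (rawE natE) (pairE natE natE))) (rawE natE) (fun t => constDigits t.1.1 t.1.2.2 t.2.2.2) :=
    constDigitsC.comp ((CodeFP.fst _ _).fst'.pair ((CodeFP.fst _ _).snd'.snd'.pair (CodeFP.snd _ _).snd'.snd'))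
  have hamt : CodeFP (pairE hkE (pairE (rawE natE) (pairE natE natE))) natE (fun t => t.1.2.1 + t.1.2.1 + t.1.2.2 * t.2.2.2) :=
    natAdd.comp ((natAdd.comp ((natOfUn.comp (CodeFP.fst _ _).snd'.fst').pair (natOfUn.comp (CodeFP.fst _ _).snd'.fst'))).pair
      (natMul.comp ((natOfUn.comp (CodeFP.fst _ _).snd'.snd').pair (CodeFP.snd _ _).snd'.snd')))
  have hvar : CodeFP (pairE hkE (pairE (rawE natE) (pairE natE natE))) (rawE natE) (fun t => cD t.1.2.1 t.1.2.2 t.2.1 t.2.2.2) :=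
    (rawTakeUn natE).comp ((CodeFP.fst _ _).snd'.snd'.pair ((rawDropNat natE).comp (hamt.pair (CodeFP.snd _ _).fst')))
  refine (htag.ite hconst hvar).congr fun t => ?_
  unfold colDigs
  simp only [decide_eq_true_eq]

/-- **The address of a described read** off `((1ʰ, 1^{kt}, 1^{kJ}), zl, rd)`: the `kt + kJ + 1`
residues of the tableau point. [cite: BabaiFortnowLund1991, §4] -/
theorem addrNC : CodeFP (pairE hkE (pairE (rawE natE) rdE)) (rawE natE) (fun t => addrN t.1.1 t.1.2.1 t.1.2.2 t.2.1 t.2.2) := by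
  have hrow : CodeFP (pairE hkE (pairE (rawE natE) rdE)) (rawE natE) (fun t => rowDigs t.1.1 t.1.2.1 t.2.1 t.2.2.1) :=
    rowDigsC.comp ((CodeFP.fst _ _).pair ((CodeFP.snd _ _).fst'.pair (CodeFP.snd _ _).snd'.fst'))
  have hcol : CodeFP (pairE hkE (pairE (rawE natE) rdE)) (rawE natE) (fun t => colDigs t.1.1 t.1.2.1 t.1.2.2 t.2.1 t.2.2.2.1) :=
    colDigsC.comp ((CodeFP.fst _ _).pair ((CodeFP.snd _ _).fst'.pair (CodeFP.snd _ _).snd'.snd'.fst'))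
  have hv : CodeFP (pairE hkE (pairE (rawE natE) rdE)) (rawE natE) (fun t => [t.2.2.2.2]) := (rawSingleton natE).comp (CodeFP.snd _ _).snd'.snd'.snd'
  exact ((rawAppend natE).comp (hrow.pair ((rawAppend natE).comp (hcol.pair hv)))).congr fun t => rfl

/-- **All read addresses of all described families** off `((1ʰ, 1^{kt}, 1^{kJ}), zl, fds)`. [folklore] -/
theorem addrsNC : CodeFP (pairE hkE (pairE (rawE natE) (rawE fdE))) (rawE (rawE (rawE natE)))
    (fun t => t.2.2.map fun fd => fd.2.1.map fun rd => addrN t.1.1 t.1.2.1 t.1.2.2 t.2.1 rd) := by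
  have hI : CodeFP (pairE (pairE (pairE hkE (pairE (rawE natE) (rawE fdE))) fdE) rdE) (rawE natE)
      (fun t => addrN t.1.1.1.1 t.1.1.1.2.1 t.1.1.1.2.2 t.1.1.2.1 t.2) :=
    addrNC.comp ((CodeFP.fst _ _).fst'.fst'.pair ((CodeFP.fst _ _).fst'.snd'.fst'.pair (CodeFP.snd _ _)))
  have hF : CodeFP (pairE (pairE hkE (pairE (rawE natE) (rawE fdE))) fdE) (rawE (rawE natE))
      (fun t => t.2.2.1.map fun rd => addrN t.1.1.1 t.1.1.2.1 t.1.1.2.2 t.1.2.1 rd) :=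
    ((CodeFP.map hI).comp ((CodeFP.id _).pair (CodeFP.snd _ _).snd'.fst')).congr fun t => rfl
  exact ((CodeFP.map hF).comp ((CodeFP.id _).pair (CodeFP.snd _ _).snd')).congr fun t => rfl

end Addr

/-! ### The descriptor list -/

section Descs

variable (M : TM2ComputableAux Bool Bool)

attribute [local instance] Turing.FinTM2.kFin Turing.FinTM2.ΛFin Turing.FinTM2.σFin
  Turing.FinTM2.Γk₀Fin

local notation "d" => dM M

/-- A unit descriptor with computed row/column constants and a constant value code. [folklore] -/
theorem unitDC {α : Type} {eα : α → List Bool} {t0 J0 : α → ℕ} (ht0 : CodeFP eα natE t0) (hJ0 : CodeFP eα natE J0) (v : Val M.tm) :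
    CodeFP eα fdE (fun a => unitD M (t0 a) (J0 a) v) := by
  have hrd : CodeFP eα rdE (fun a => ((0, t0 a), (0, J0 a), vc M v)) :=
    ((CodeFP.const _ (0 : ℕ)).pair ht0).pair (((CodeFP.const _ (0 : ℕ)).pair hJ0).pair (CodeFP.const _ (vc M v)))
  exact ((CodeFP.const _ (0 : ℕ)).pair (((rawSingleton rdE).comp hrd).pair ((CodeFP.const _ ([] : List ℕ)).pair (CodeFP.const _ [0])))).congr
    fun a => rfl

/-- **`xDescs M x` off the string `x`.** [folklore] -/
theorem xDescsC : CodeFP strE (rawE fdE) (xDescs M) := by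
  -- item `i ↦ [unitD 0 (2i+1) (symVal x[i]), unitD 0 (2i+2) (symVal x[i])]`
  have hb : CodeFP (pairE strE natE) bitE (fun t => t.1.getD t.2 false) := strGetDNat
  have h21 : CodeFP (pairE strE natE) natE (fun t => 2 * t.2 + 1) :=
    natAdd.comp ((natMul.comp ((CodeFP.const _ 2).pair (CodeFP.snd _ _))).pair (CodeFP.const _ 1))
  have h22 : CodeFP (pairE strE natE) natE (fun t => 2 * t.2 + 2) :=
    natAdd.comp ((natMul.comp ((CodeFP.const _ 2).pair (CodeFP.snd _ _))).pair (CodeFP.const _ 2))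
  have hT : CodeFP (pairE strE natE) (rawE fdE)
      (fun t => [unitD M 0 (2 * t.2 + 1) (symVal M true), unitD M 0 (2 * t.2 + 2) (symVal M true)]) :=
    ((rawCons fdE).comp ((unitDC M (CodeFP.const _ 0) h21 (symVal M true)).pair
      ((rawSingleton fdE).comp (unitDC M (CodeFP.const _ 0) h22 (symVal M true))))).congr fun t => rfl
  have hF : CodeFP (pairE strE natE) (rawE fdE)
      (fun t => [unitD M 0 (2 * t.2 + 1) (symVal M false), unitD M 0 (2 * t.2 + 2) (symVal M false)]) :=
    ((rawCons fdE).comp ((unitDC M (CodeFP.const _ 0) h21 (symVal M false)).pair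
      ((rawSingleton fdE).comp (unitDC M (CodeFP.const _ 0) h22 (symVal M false))))).congr fun t => rfl
  have hI : CodeFP (pairE strE natE) (rawE fdE)
      (fun t => [unitD M 0 (2 * t.2 + 1) (symVal M (t.1.getD t.2 false)), unitD M 0 (2 * t.2 + 2) (symVal M (t.1.getD t.2 false))]) :=
    (hb.ite hT hF).congr fun t => by cases t.1.getD t.2 false <;> rfl
  have hL : CodeFP strE (rawE natE) (fun x => List.range x.length) := urange.comp strLength
  refine (((CodeFP.flatten fdE).comp ((CodeFP.map hI).comp ((CodeFP.id _).pair hL)))).congr fun x => ?_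
  unfold xDescs
  rw [List.flatMap_def]
  dsimp only [Function.comp_apply, _root_.id]
  congr 1
  apply List.ext_getElem
  · simp
  · intro i h1 h2
    rw [List.getElem_map, List.getElem_map, List.getElem_range, List.getElem_zipIdx, Nat.zero_add,
      List.getD_eq_getElem _ _ (by simpa using h1)]

/-- The context `(n, 1ᴾ, T)` of the descriptor list. [folklore] -/
abbrev nptE : ℕ × ℕ × ℕ → List Bool := pairE natE (pairE unE natE)

/-- `certAnyD M n j` off `((n, 1ᴾ, T), j)`. [folklore] -/
theorem certAnyDC : CodeFP (pairE nptE natE) fdE (fun t => certAnyD M t.1.1 t.2) := by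
  have hc : CodeFP (pairE nptE natE) natE (fun t => 2 * t.1.1 + 3 + t.2) :=
    natAdd.comp ((natAdd.comp ((natMul.comp ((CodeFP.const _ 2).pair (CodeFP.fst _ _).fst')).pair (CodeFP.const _ 3))).pair (CodeFP.snd _ _))
  have hrd : ∀ k : Fin 3, CodeFP (pairE nptE natE) rdE (fun t => ((0, 0), (0, 2 * t.1.1 + 3 + t.2), vc M (certVal M k))) := fun k =>
    (CodeFP.const _ ((0 : ℕ), (0 : ℕ))).pair (((CodeFP.const _ (0 : ℕ)).pair hc).pair (CodeFP.const _ (vc M (certVal M k))))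
  have hl : CodeFP (pairE nptE natE) (rawE rdE) (fun t => [((0, 0), (0, 2 * t.1.1 + 3 + t.2), vc M (certVal M 0)),
      ((0, 0), (0, 2 * t.1.1 + 3 + t.2), vc M (certVal M 1)), ((0, 0), (0, 2 * t.1.1 + 3 + t.2), vc M (certVal M 2))]) :=
    ((rawCons rdE).comp ((hrd 0).pair ((rawCons rdE).comp ((hrd 1).pair ((rawSingleton rdE).comp (hrd 2)))))).congr fun t => rfl
  exact ((CodeFP.const _ (0 : ℕ)).pair (hl.pair ((CodeFP.const _ ([] : List ℕ)).pair (CodeFP.const _ [0, 1, 2])))).congr fun t => rfl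

/-- `certNextD M n j` off `((n, 1ᴾ, T), j)`. [folklore] -/
theorem certNextDC : CodeFP (pairE nptE natE) fdE (fun t => certNextD M t.1.1 t.2) := by
  have hc : CodeFP (pairE nptE natE) natE (fun t => 2 * t.1.1 + 3 + t.2) :=
    natAdd.comp ((natAdd.comp ((natMul.comp ((CodeFP.const _ 2).pair (CodeFP.fst _ _).fst')).pair (CodeFP.const _ 3))).pair (CodeFP.snd _ _))
  have h0 : CodeFP (pairE nptE natE) rdE (fun t => ((0, 0), (0, 2 * t.1.1 + 3 + t.2), vc M (noneVal M.tm))) :=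
    (CodeFP.const _ ((0 : ℕ), (0 : ℕ))).pair (((CodeFP.const _ (0 : ℕ)).pair hc).pair (CodeFP.const _ (vc M (noneVal M.tm))))
  have h1 : CodeFP (pairE nptE natE) rdE (fun t => ((0, 0), (0, 2 * t.1.1 + 3 + t.2 + 1), vc M (noneVal M.tm))) :=
    (CodeFP.const _ ((0 : ℕ), (0 : ℕ))).pair (((CodeFP.const _ (0 : ℕ)).pair (natAdd.comp (hc.pair (CodeFP.const _ 1)))).pair
      (CodeFP.const _ (vc M (noneVal M.tm))))
  have hl : CodeFP (pairE nptE natE) (rawE rdE) (fun t => [((0, 0), (0, 2 * t.1.1 + 3 + t.2), vc M (noneVal M.tm)),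
      ((0, 0), (0, 2 * t.1.1 + 3 + t.2 + 1), vc M (noneVal M.tm))]) :=
    ((rawCons rdE).comp (h0.pair ((rawSingleton rdE).comp h1))).congr fun t => rfl
  exact ((CodeFP.const _ (0 : ℕ)).pair (hl.pair ((CodeFP.const _ [0]).pair (CodeFP.const _ [1])))).congr fun t => rfl

/-- `botD M n P T r` off `((n, 1ᴾ, T), r)`. [folklore] -/
theorem botDC : CodeFP (pairE nptE natE) fdE (fun t => botD M t.1.1 t.1.2.1 t.1.2.2 t.2) := by
  have hNN : CodeFP (pairE nptE natE) natE (fun t => NN t.1.1 t.1.2.1) :=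
    (natAdd.comp ((natAdd.comp ((natMul.comp ((CodeFP.const _ 2).pair (CodeFP.fst _ _).fst')).pair (CodeFP.const _ 2))).pair
      (natOfUn.comp (CodeFP.fst _ _).snd'.fst'))).congr fun t => by simp [NN]
  have hc : CodeFP (pairE nptE natE) natE (fun t => NN t.1.1 t.1.2.1 + d * t.1.2.2 + 2 * d + 1 + t.2) :=
    natAdd.comp ((natAdd.comp ((natAdd.comp ((natAdd.comp (hNN.pair (natMul.comp ((CodeFP.const _ d).pair (CodeFP.fst _ _).snd'.snd')))).pair
      (CodeFP.const _ (2 * d)))).pair (CodeFP.const _ 1))).pair (CodeFP.snd _ _))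
  have hrd : CodeFP (pairE nptE natE) rdE (fun t => ((2, 0), (0, NN t.1.1 t.1.2.1 + d * t.1.2.2 + 2 * d + 1 + t.2), vc M (noneVal M.tm))) :=
    (CodeFP.const _ ((2 : ℕ), (0 : ℕ))).pair (((CodeFP.const _ (0 : ℕ)).pair hc).pair (CodeFP.const _ (vc M (noneVal M.tm))))
  exact ((CodeFP.const _ (2 : ℕ)).pair (((rawSingleton rdE).comp hrd).pair ((CodeFP.const _ ([] : List ℕ)).pair (CodeFP.const _ [0])))).congr
    fun t => rfl

/-- **`nDescs M n P T` off `(n, 1ᴾ, T)`.** [cite: BabaiFortnowLund1991, §4] -/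
theorem nDescsC : CodeFP nptE (rawE fdE) (fun t => nDescs M t.1 t.2.1 t.2.2) := by
  classical
  -- the six leading families
  have hn21 : CodeFP nptE natE (fun t => 2 * t.1 + 1) := natAdd.comp ((natMul.comp ((CodeFP.const _ 2).pair (CodeFP.fst _ _))).pair (CodeFP.const _ 1))
  have hn22 : CodeFP nptE natE (fun t => 2 * t.1 + 2) := natAdd.comp ((natMul.comp ((CodeFP.const _ 2).pair (CodeFP.fst _ _))).pair (CodeFP.const _ 2))
  have h6 : CodeFP nptE (rawE fdE) (fun t => [unitD M 0 0 (ctrlVal M), unitD M 0 (2 * t.1 + 1) (symVal M false),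
      unitD M 0 (2 * t.1 + 2) (symVal M true), tailD M, unitD M t.2.2 1 (accVal M), cellAnyD M]) :=
    ((rawCons fdE).comp ((CodeFP.const _ (unitD M 0 0 (ctrlVal M))).pair ((rawCons fdE).comp
      ((unitDC M (CodeFP.const _ 0) hn21 (symVal M false)).pair ((rawCons fdE).comp
      ((unitDC M (CodeFP.const _ 0) hn22 (symVal M true)).pair ((rawCons fdE).comp ((CodeFP.const _ (tailD M)).pair
      ((rawCons fdE).comp ((unitDC M (CodeFP.snd _ _).snd' (CodeFP.const _ 1) (accVal M)).pair
      (CodeFP.const _ [cellAnyD M]))))))))))).congr fun t => rfl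
  -- the certificate families
  have hcertI : CodeFP (pairE nptE natE) (rawE fdE) (fun t => [certAnyD M t.1.1 t.2, certNextD M t.1.1 t.2]) :=
    ((rawCons fdE).comp ((certAnyDC M).pair ((rawSingleton fdE).comp (certNextDC M)))).congr fun t => rfl
  have hcert : CodeFP nptE (rawE fdE) (fun t => (List.range t.2.1).flatMap fun j => [certAnyD M t.1 j, certNextD M t.1 j]) :=
    ((CodeFP.flatten fdE).comp ((CodeFP.map hcertI).comp ((CodeFP.id _).pair (urange.comp (CodeFP.snd _ _).fst')))).congr fun t => by
      rw [List.flatMap_def]; rfl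
  -- the bottom families
  have hbot : CodeFP nptE (rawE fdE) (fun t => (List.range d).map fun r => botD M t.1 t.2.1 t.2.2 r) :=
    (CodeFP.map (botDC M)).comp ((CodeFP.id _).pair (CodeFP.const _ (List.range d)))
  refine ((rawAppend fdE).comp (((rawAppend fdE).comp (((rawAppend fdE).comp (((rawAppend fdE).comp
    (((rawAppend fdE).comp (h6.pair hcert)).pair (CodeFP.const _
      ((allTuples M (3 * d + 1)).flatMap fun a => (List.finRange (2 * d + 1)).map fun r => topD M a r)))).pair
    (CodeFP.const _ ((allTuples M (d + 1)).flatMap fun hd' => (allTuples M (2 * d + 1)).map fun nb => intD M hd' nb)))).pair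
    hbot)).pair (CodeFP.const _
      ((allVals M).flatMap fun v => (allVals M).flatMap fun v' => if v = v' then [] else [cellPairD M v v'])))).congr fun t => ?_
  rfl

/-- **The descriptor list `descs M n P T x` off `((n, 1ᴾ, T), x)`.** [cite: BabaiFortnowLund1991, §4] -/
theorem descsC : CodeFP (pairE nptE strE) (rawE fdE) (fun t => descs M t.1.1 t.1.2.1 t.1.2.2 t.2) :=
  ((rawAppend fdE).comp (((xDescsC M).comp (CodeFP.snd _ _)).pair ((nDescsC M).comp (CodeFP.fst _ _)))).congr fun _ => rfl

end Descs

end TabEval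

end Literature.Computability.Complexity

end
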